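import HarnessLib
import Summits.RiemannHypothesis.RiemannHypothesis.Theorems.SignConePointwiseCertThreeHalvesData

/-!
# Route SignCone: pointwise certificate `pwCert32` — anchored grid groups, file 21 (first half)

Support for the unconditional rungs of `SignConeOscillatory` / `SignConeInequality`
(items stmt-RiemannHypothesis-16302 / 16301). Anchored grid groups `(w, [u₀ < u₁ < …])` of the
certificate `pwCert32` (`5` groups, `294` two-point cells on `[251.9370, 277.5615]`, in
`5` slices) and their kernel checks with the corrected fast checker (`PWData.checkAGrid₂Z`:
`w ≤ wLoQ(u₀)` at the anchor, tables `pwCert32cs/pwCert32logs`, correction `pwCert32hl`, two-point cells), combined in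
`pwCert32_groups21`. Assembled in `SignConePointwiseCertThreeHalves.lean`.
-/

-- `Summit.RiemannHypothesis.RiemannHypothesis.…` repeats a namespace component by design (D-0017 layout).
set_option linter.dupNamespace false

noncomputable section

namespace Summit.RiemannHypothesis.RiemannHypothesis.Theorems.SignCone

open Literature.Analysis.ValidatedNumerics.Numerics Literature.NumberTheory.LFunctions

/-- Anchored grid groups, file 21 slice 0 (`1` groups, `54` cells on `[251.9370, 256.8494]`). [folklore] -/
def pwCert32G21s0 : List (ℚ × List ℚ) := [
  pwCert32Grp (8710426742550693868469539/1801439850948198400000000) [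
    1031934, 1032160, 1032476, 1032788, 1033102, 1033424, 1033760, 1034116, 1034506, 1034929, 1035389, 1035877, 1036399, 1036949, 1037516, 1037917,
    1038315, 1038706, 1039087, 1039454, 1039806, 1040140, 1040456, 1040753, 1041032, 1041294, 1041541, 1041774, 1041995, 1042206, 1042409, 1042606,
    1042881, 1043152, 1043425, 1043706, 1044001, 1044327, 1044690, 1045103, 1045581, 1046138, 1046781, 1047485, 1048239, 1048767, 1049274, 1049747,
    1050181, 1050575, 1050931, 1051252, 1051544, 1051810, 1052055]]

/-- Anchored grid groups, file 21 slice 1 (`1` groups, `60` cells on `[256.8494, 261.8433]`). [folklore] -/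
def pwCert32G21s1 : List (ℚ × List ℚ) := [
  pwCert32Grp (2186302915516348034402541/450359962737049600000000) [
    1052055, 1052283, 1052496, 1052697, 1052887, 1053069, 1053245, 1053415, 1053582, 1053816, 1054048, 1054280, 1054515, 1054757, 1055008, 1055271,
    1055550, 1055848, 1056175, 1056529, 1056913, 1057321, 1057759, 1058225, 1058713, 1059214, 1059566, 1059915, 1060257, 1060590, 1060912, 1061223,
    1061523, 1061813, 1062094, 1062368, 1062638, 1063020, 1063404, 1063798, 1064213, 1064671, 1065179, 1065752, 1066398, 1067098, 1067848, 1068377,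
    1068888, 1069366, 1069803, 1070198, 1070553, 1070873, 1071163, 1071428, 1071672, 1071899, 1072113, 1072316, 1072510]]

set_option maxHeartbeats 0 in
/-- **Kernel check of slice 0 of file 21.** [folklore] -/
theorem pwCert32G21s0_ok : (pwCert32G21s0.all (pwCert32.checkAGrid₂Z pwCert32cs pwCert32logs pwCert32fac pwCert32hl)) = true := by
  decide +kernel

set_option maxHeartbeats 0 in
/-- **Kernel check of slice 1 of file 21.** [folklore] -/
theorem pwCert32G21s1_ok : (pwCert32G21s1.all (pwCert32.checkAGrid₂Z pwCert32cs pwCert32logs pwCert32fac pwCert32hl)) = true := by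
  decide +kernel

end Summit.RiemannHypothesis.RiemannHypothesis.Theorems.SignCone

end
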